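import Summits.QuantumFields.YangMills.Theorems.BalabanUVNodesN08AtRecord13CoPRLaneFamily
import Summits.QuantumFields.YangMills.Theorems.BalabanUVNodesN08AlphaProfileSUEnd
import Literature.MathematicalPhysics.QuantumFieldTheory.Balaban1983to89.B10LeafUnpinnedRecord5C

/-!
# BalabanUVNodes ∕ N08 AT THE v1.6 STAGE-13 RECORD THROUGH THE RE-BOUND [B10] LAYER AT dag-n08-d's CHOSEN EXTERNAL INPUTS `XeOf` — THE (α) CLAUSE WITH ITS IN-EDGE SIDE EMPTY, KNIT INTO
# THE RECORD — v1.6 `CoPR` EDITION OF RECORD 13 (director-ym LINE №169 (H1) ∕ №174 PRESS WORD; FINDING №8 = node00-def-T LOCATED-8 «the residual 𝐓-weight slot `Stage12Params.Zt K` is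
RUN-BLIND while print's ζ ([Balaban1988Convergent] (1.11) p.248, (3.16)–(3.20) pp.268–269) reads the run»): def-T FILE 25 `Node00/Record13CoPR` (p529474 ✓ 3eadf656eaa8:
`structure Stage13RParams extends Stage13Params` + the ONE new field `Zr : (p : B12.RunParams) → TkResidualW F N (FluctV N) p.K`, guard `Stage13RParams.ZrUnity`, 𝐓-weights
`WtOfRecord₁₃R θ p` reading `θ.Zr p`, the C-keyed provisos `Stage13RParams.Provisos₁₃CoPR` (the nine Core rows + `zrLaws ∕ zrLocal`), view `Stage13RParams.toStage5₁₃CoPR`, datum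
`datumOfRecord₁₃CoPR`, record `IsRecordOfRecord₁₃CCoPR` + faces; run-blind embedding `Stage13RParams.ofRunBlind`) and FILE 26T `Node00/Record13SepCoPR` (p529780 ✓: `Provisos₁₃SepCoPR`,
`datumOfRecord₁₃SepCoPR`, `IsRecordOfRecord₁₃CSepCoPR` + `.toCoPR`); dag-n10-d's R carrier leaves `Node00/Record13CarriersCoPR` (p530591 ✓: §0 THE R-PIN ALGEBRA `Stage13RParams.onBase ∕ rebindX ∕
pin<G>` (dag-lead DEDUP-286 (2), this seat's DESIGN-INPUT-R), `toStage5₁₃CoPR_rebindX ∕ _pin<G>`, `Provisos₁₃CoPR.rebindX ∕ .pin<G>`, `datumOfRecord₁₃CoPR_rebindX ∕ _pin<G>`,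
`isRecordOfRecord₁₃CCoPR_rebindX_of_eq ∕ _pinB10_of_eq`, `exists_world_isRecordOfRecord₁₃CCoPR_rebindX`, the R views `Stage13RParams.view₁₃CoPRB10YZW ∕ …B8B10YZW` + `_eq` + `_leaves`) and
`Node00/Record13CarriersSepCoPR` (n10-d file (2), in the tree 12:36Z: `Provisos₁₃SepCoPR.pin<G>`, `datumOfRecord₁₃SepCoPR_pin<G>`, `isRecordOfRecord₁₃CSepCoPR_pinB10_of_eq`).  Token map T₆ (plan IMPACT-169, def-T KEYMAP v1.6,
dag-lead WORDS-142): «the v1.5 names with `CoP ↦ CoPR`, binders `Stage13Params ↦ Stage13RParams`, `ZtUnity ↦ ZrUnity`, `Provisos₁₃Core ↦ Provisos₁₃CoPR` (C-keyed family), `θ.Zt p.K ↦ θ.Zr p`».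
# THIS FILE = the T₆ image of `BalabanUVNodesN08AtRecord13CoPLaneXeOf` (p526773; the CoP image of the knit p522919): N08's lane conjunct at an `IsRecordOfRecord₁₃CCoPR` record from `θ`'s
# provisos ∕ admissibility ∕ guard and the cluster-expansion DATA SCHEMA at `XeOf` ALONE (generic gauge group `G` with a direction `X ∈ 𝔤 ∖ 0` and the size condition `4π ≤ C68`; for
# `SU(M)`, `M ≥ 2`, at the bumped constants `bump68 𝔠₀` with NO structural hypothesis) — dag-n08-d g5's record-free END forms `BalabanUVNodesN08AlphaProfileRecord.b10_main_upC_XeOf` (F9)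
# ∕ `…ProfileGroupSU` (F10: `suDir`) ∕ `…ProfileConsts` (F11: `four_pi_le_regMin_bump68`) ∕ `…ProfileSUEnd` (F12, p514827) composed BY NAME with dag-n10-d's R re-binding face
# `Node00.exists_world_isRecordOfRecord₁₃CCoPR_rebindX` and def-T's C-binding identity `Node00.upOfRecord₅C_eq` (Track A, DAG node N08 [Balaban1985UV3] CMP **102** (1985) 255, Thm 1 p. 257 (compact reading) + Thm 2 p. 272; R134 fan-out seat `pub-ymgap-dag-n08-c` g16, strategy s2
«knit at the record of record», trigger (t27) = №174 (3) «pens port their OWN files»; 2026-08-27)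

WHY THIS FILE.  p526773 keys on `Stage13Params ∕ Provisos₁₃Core ∕ IsRecordOfRecord₁₃CCoP` and re-binds with the parent's `rebindX`; at v1.6 the re-binding is dag-n10-d's R-level
`Stage13RParams.rebindX` and the view `toStage5₁₃CoPR` (`Stage13RParams.toStage5₁₃CoPR_rebindX`, `rfl`), so the knit is re-typed here under T₆.  The `rfl` glue «Stage-3 substitutions
commute with re-binding the B10 group» and «the C-binding of record over a tower-run residual carrier IS `ofPrintedAllXPNC ((carriers₃ σ₃ Xc).withTowerRuns10 T) (Y P) (Z P) (V P) (W P)`»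
is CITED from `B10LeafUnpinnedRecord5C` §4 (`carriers₃_withTowerRuns10`, `upOfRecord₅C_eq_of_towerRuns` — `Stage5Params`-generic, edition-free).  §3 is stated at the R-LIFT of K0a's
all-numerics maker (departure (ii) below).
HONEST DEPARTURES FROM A PURE TOKEN IMAGE (generator `tools/copr_n08_gen.py` + `tools/genericize_witness_n08.py`; every other statement SHAPE verbatim, proofs re-checked):
(i) the 𝐑-bundle `WOfRecord₁₃` (12a; reads no 𝐓-slot, NOT re-issued by def-T) is fed the base `θ.toStage13Params` (plan's K1 v4 text does the same); (ii) every WITNESS-LINE theorem is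
stated at the R-LIFT `⟨θ₀, Zr⟩ : Stage13RParams F N` of node00-def-K0a's v1.5 maker `θ₀` (`theta13LiveOfRecord ∕ theta13LiveOfNumerics … ∕ theta13LiveOfFamily₂ …`, θ-level and
background-free) by an ARBITRARY run-indexed residual family `Zr`; admissibility and `SlotsNondegenerate₁₃` of the lift ARE K0a's faces of `θ₀` through the base (definitional), while
the guard half `ZrUnity` — whose K0a hypothesis-free face `ztUnity_…` has no R image until K0a pins `Zr` (№174 (5)) — is DISPLAYED as `hZ` in the `N = 2` forms (K0a FILE 17
`ZrOfRecord₁₃ ∕ finsum_ζ0_ZrOfRecord₁₃`, dag-n11-d's diagonal cure as a definition, discharges it at `Zr := ZrOfRecord₁₃ F N θ₀`: `fun p j ω => finsum_ζ0_ZrOfRecord₁₃ …`).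

WHAT IS PROVED (kernel bookkeeping BY NAME; 0 `def`, 0 `sorry`).
* §1 generic `G`: ★ `exists_world₁₃CCoPR_laneXeOf_b10_main_of_data` — from `θ`, `h : θ.Provisos₁₃CoPR F N`, admissibility, the lane letters `(𝔊, 𝔠, hC, X, hX, hX0, X₀, hstd, w, Bk)` at
  block size `θ.L`, expansion ∕ auxiliary data `𝔖 ∕ 𝔄 ∕ coef` and THE DATA SCHEMA AT `XeOf` on the window: a world (any window height `γw`, block size `θ.L`) that IS a ₁₃CCoPR record
  of `datumOfRecord₁₃CoPR F N θ h`, bound over the R view of `θ.rebindX (lane family at XeOf)`, with `Dag.B10_main (leavesP w P)` at every run; ★ `exists_guarded_record₁₃CCoPR_laneXeOf_b10_main_of_data`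
  — N08's conjunct shape of a C-keyed `NodesAtSomeRecord13`, witnessed AT `θ`; ★ `…_of_inhabited13CoPR` — «C-keyed inhabitation `∃ θ, Provisos₁₃CoPR ∧ guard ∧ Admissible` + AT EVERY
  ODD `L > 1` lane letters with the DATA schema at `XeOf` ⟹ N08's conjunct» (the (α) programme's displayed inputs in place of the slot socket of `…N08AtRecord13CoPR` §2 — no in-edge face).
* §2 `G = SU(M)`, `M ≥ 2`, at `bump68 𝔠₀` (direction `suDir`, size condition a theorem): ★★ `exists_world₁₃CCoPR_laneXeOf_b10_main_of_data_su_bump`,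
  ★★ `exists_guarded_record₁₃CCoPR_laneXeOf_b10_main_of_data_su_bump`, ★★ `…_of_inhabited13CoPR_su_bump` (+ `_two`: the record's own group `N = 2` on the 𝕋⁴ side AND the lane group `SU(2)`).
* §3 ★★ `…_at_theta13LiveOfNumerics_of_data_su_bump` — at the R-lift `⟨θL, Zr⟩` of K0a's all-numerics member (block size `F.L`), provisos OPAQUE, `hZ` displayed, lane `SU(2)`.
HONEST FRAMING — PLEASE READ.  The re-bound [B10] layer here is THE LANE'S constructed family at n08-d's chosen inputs `XeOf` (standard averaging, the lane's exact Haar-compatibility field; `XeOf` is n08-d's DEFINITION — a choice of minimisers — not data of print), NOT print's run family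
of record (`runsB10OfRecord`, the `pinB10` layer) — hence NOT the slot `Node00.PrintedUV3V N θ.L` and NOT a re-pointing of S1; whether N08's COUNT may be read there is the chair's
species word (seam E6′, R451 ∕ R454).  Count-neutral re-keying of a LANDED storey to the re-issued record (new file; p526773 stays as the ⁵ sibling).  The DATA schema `RunDataRows`
(the [B10] §§2–3 cluster expansion at the lane's run objects — class II of the n08-b census = the object gap in data form), the in-edge hypotheses where displayed, the provisos,
admissibility, the guard and every window inequality are DISPLAYED hypotheses; nothing of Bałaban's asserted; K0 ∕ K1 neither proved nor assumed; N08 NOT discharged; one finite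
four-torus per run at fixed `ε`, the lane's d = 3 tori inside the record; nothing continuum ∕ ℝ⁴ ∕ OS ∕ mass gap ∕ Clay.  0 `sorry`, 0 `def`, standard axioms.
Sources: [Balaban1985UV3] Thm 1 p.257 (compact reading), Thm 2 p.272, (41)–(42) p.266, (44) p.267, (67)–(68) p.273, p.256 L15–18; [Balaban1985Variational] Thm 1 p.279;
[Balaban1985Averaging] Prop. 2 (54) p.26; [Balaban1989LargeFieldII] Thm 1 + (0.1) pp.355–356; [Balaban1988Convergent] p.244, (1.11) p.248, (2.18) p.257, (3.16)–(3.22) pp.268–269;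
[Balaban1987RG1] Thm 1 p.255; [Balaban1984PropagatorsII] pp.223–250 (the Stage-3 carriers).
-/

noncomputable section

namespace Summit.QuantumFields.YangMills.BalabanUVNodes.N08AtRecord13CoPRLaneXeOf

open MeasureTheory
open scoped BigOperators Matrix Matrix.Norms.L2Operator
open Literature.MathematicalPhysics.QuantumFieldTheory.Balaban1983to89
open Literature.MathematicalPhysics.QuantumFieldTheory.Balaban1983to89.B10
open Literature.MathematicalPhysics.QuantumFieldTheory.Balaban1983to89.B10SectCExpansion (TermSizes)
open Literature.MathematicalPhysics.QuantumFieldTheory.Balaban1985CMP102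
open Literature.MathematicalPhysics.QuantumFieldTheory.Balaban1985CMP102.Setting
open Literature.MathematicalPhysics.QuantumFieldTheory.Balaban1983to89.T4Continuum (T4Family FiniteEpsData)
open Literature.MathematicalPhysics.QuantumFieldTheory.Balaban1983to89.DagBinding (leavesP WorldP PrintedCarriersR PrintedCarriers9X PrintedCarriers11 PrintedCarriers14R
  PrintedCarriers15)
open Literature.MathematicalPhysics.QuantumFieldTheory.Balaban1983to89.B10CompactBinding (ofPrintedAllXPNC)
open Literature.MathematicalPhysics.QuantumFieldTheory.Balaban1983to89.Node00
open Summit.QuantumFields.Balaban3D.Carriers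
open Summit.QuantumFields.Balaban3D.Proofs.Inputs
open Summit.QuantumFields.Balaban3D.Proofs.Primitives (AlphaConsts)
open Summit.QuantumFields.Balaban3D.Proofs.GroupModelLieC (lieC)
open Summit.QuantumFields.Balaban3D.Proofs.UVStability3DInputs
open Summit.QuantumFields.Balaban3D.Proofs.FamilyLE (ScalesLE)
open Summit.QuantumFields.YangMills.Theorems.BalabanUVNodesN08AlphaClassI
open Summit.QuantumFields.YangMills.Theorems.BalabanUVNodesN08AlphaLoop28
open Summit.QuantumFields.YangMills.Theorems.BalabanUVNodesN08AlphaThreeFaces (regMin)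
open Summit.QuantumFields.YangMills.Theorems.BalabanUVNodesN08AlphaProfileThreshold
open Summit.QuantumFields.YangMills.Theorems.BalabanUVNodesN08AlphaProfileRecord
open Summit.QuantumFields.YangMills.Theorems.BalabanUVNodesN08AlphaProfileGroupSU
open Summit.QuantumFields.YangMills.Theorems.BalabanUVNodesN08AlphaProfileConsts
open Summit.QuantumFields.YangMills.BalabanUVNodes.N08AtRecord13CoPR

variable {F : T4Family} {N : ℕ} [NeZero N]

/-! ## §1 GENERIC GAUGE GROUP: N08 AT THE CoPR RECORD FROM THE DATA SCHEMA AT `XeOf` ALONE -/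

section Generic
variable {G : Type} [GaugeGroup G] [MeasurableSpace G] [HaarData G] (𝔊 : GroupModel G)

/-- **★ A ₁₃CCoPR RECORD OF `datumOfRecord₁₃CoPR F N θ h` BOUND OVER THE CoPR VIEW OF THE LANE-RE-BOUND PARAMETERS AT `XeOf`, CARRYING N08 AT EVERY RUN, FROM THE DATA SCHEMA AT
`XeOf` ALONE** (any window `γw`, block size `θ.L`): lane letters `𝔠` with `4π ≤ (regMin 𝔠).C68`, a direction `X ∈ 𝔤 ∖ 0`, base inputs `X₀` with the standard averaging, `w`, `Bk`;
expansion data `𝔖`, auxiliary data `𝔄`, sizes `coef`; DISPLAYED: `RunDataRows` at `XeOf …` on the window `g²ε₀ ≤ (min γ_N08^d 1)²`.  World by n10-d's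
`exists_world_isRecordOfRecord₁₃CCoPR_rebindX`; N08 by n08-d's `b10_main_upC_XeOf` at the `ofPrintedAllXPNC` word the record's world unfolds to (`B10LeafUnpinnedRecord5C.upOfRecord₅C_eq_of_towerRuns`) — NO in-edge hypothesis. [cite: Balaban1985UV3, Thm 1 p.257 (compact reading) + Thm 2 p.272 + (41)–(42) p.266 + (67)–(68) p.273; Balaban1985Variational, Thm 1 p.279; Balaban1985Averaging, Prop. 2 (54) p.26; Balaban1989LargeFieldII, Thm 1 + (0.1) pp.355–356 (bookkeeping)] -/
theorem exists_world₁₃CCoPR_laneXeOf_b10_main_of_data (θ : Stage13RParams F N) (h : θ.Provisos₁₃CoPR F N) (hθ : θ.Admissible F N)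
    (𝔠 : AlphaConsts θ.L 𝔊.N) (hC : 4 * Real.pi ≤ (regMin 𝔠).C68) {X : Matrix (Fin 𝔊.N) (Fin 𝔊.N) ℂ} (hX : X ∈ 𝔊.lie) (hX0 : X ≠ 0)
    (X₀ : ∀ S : Scales θ.L, ExternalInputs S G) (hstd : ∀ S : Scales θ.L, (X₀ S).av = AveragingRT.stdAvg S.P G) (w : ℝ)
    (Bk : ∀ (S : Scales θ.L) (k : ℕ), Hist S.P k → Set (PBond S.P k))
    (𝔖 : ∀ (S : Scales θ.L) (k : ℕ), StepSeries S G ↥(lieC 𝔊) (nblkOf S 𝔠.lane.carrier k) k)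
    (𝔄 : ∀ S : Scales θ.L, AlphaData 𝔊 𝔠 (XeOf 𝔊 𝔠 X₀ hstd w hX hX0 hC Bk S) (𝔖 S))
    (coef : ∀ (S : Scales θ.L) (k : ℕ), Hist S.P (k + 1) → GaugeField S.P (k + 1) G → (j : ℕ) → TermSizes (oldGeom S.P k j))
    (hD : ∀ S : Scales θ.L, S.g ^ 2 * S.ε₀ ≤ (min (gammaN08d 𝔠) 1) ^ 2 →
      RunDataRows 𝔊 𝔠 (XeOf 𝔊 𝔠 X₀ hstd w hX hX0 hC Bk S) (𝔖 S) (𝔄 S) (sizesOf 𝔊 𝔠 (XeOf 𝔊 𝔠 X₀ hstd w hX hX0 hC Bk S) (coef S)))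
    {γw : ℝ} (hγw : 0 < γw ∧ γw ≤ θ.γ) :
    ∃ w' : WorldP, IsRecordOfRecord₁₃CCoPR F N (datumOfRecord₁₃CoPR F N θ h) w' ∧ w'.γ = γw ∧ w'.L = (θ.L : ℝ) ∧
      (∀ P, w'.up P = upOfRecord₅C F N ((θ.rebindX F N fun P => (θ.res.X P).withTowerRuns10
        fun S : ScalesLE θ.L ((min (gammaN08d 𝔠) 1) ^ 2) => towerOf 𝔠.lane (XeOf 𝔊 𝔠 X₀ hstd w hX hX0 hC Bk S.1) (𝔖 S.1)).toStage5₁₃CoPR F N) P) ∧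
      ∀ P : B12.RunParams, Dag.B10_main (leavesP w' P) := by
  obtain ⟨w', hR, hγ, hL, hup⟩ := exists_world_isRecordOfRecord₁₃CCoPR_rebindX F N θ h hθ
    (fun P => (θ.res.X P).withTowerRuns10
      fun S : ScalesLE θ.L ((min (gammaN08d 𝔠) 1) ^ 2) => towerOf 𝔠.lane (XeOf 𝔊 𝔠 X₀ hstd w hX hX0 hC Bk S.1) (𝔖 S.1)) hγw
  refine ⟨w', hR, hγ, hL, hup, fun P => ?_⟩
  -- the record's world IS n08-d's `ofPrintedAllXPNC` word (n10-d's `toStage5₁₃CoPR_rebindX` + `B10LeafUnpinnedRecord5C.upOfRecord₅C_eq_of_towerRuns`, both `rfl`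
  -- bookkeeping), so n08-d's record-free closer applies at it
  have hup' := (hup P).trans (((congrArg (fun σ => upOfRecord₅C F N σ P) (Stage13RParams.toStage5₁₃CoPR_rebindX F N θ _))).trans
    (B10LeafUnpinnedRecord5C.upOfRecord₅C_eq_of_towerRuns _ P (θ.res.X P) _ rfl))
  exact b10_main_upC_XeOf 𝔊 𝔠 X₀ hstd w hX hX0 hC Bk 𝔖 𝔄 coef _ _ _ _ _ w' P hD hup'

/-- **★ N08's CONJUNCT SHAPE OF A CORE-KEYED `NodesAtSomeRecord13`, WITNESSED AT `θ`, FROM THE DATA SCHEMA AT `XeOf` ALONE** (plus `θ`'s Core provisos, admissibility and guard;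
the presenting re-bound parameter is inside the ∃ of `IsRecordOfRecord₁₃CCoPR`). [cite: Balaban1985UV3, Thm 1 p.257 (compact reading) + Thm 2 p.272; Balaban1989LargeFieldII, Thm 1 + (0.1) pp.355–356; Balaban1988Convergent, (3.16)–(3.22) pp.268–269 (bookkeeping)] -/
theorem exists_guarded_record₁₃CCoPR_laneXeOf_b10_main_of_data (θ : Stage13RParams F N) (h : θ.Provisos₁₃CoPR F N) (hθ : θ.Admissible F N)
    (hG : θ.ZrUnity F N ∧ θ.SlotsNondegenerate₁₃ F N)
    (𝔠 : AlphaConsts θ.L 𝔊.N) (hC : 4 * Real.pi ≤ (regMin 𝔠).C68) {X : Matrix (Fin 𝔊.N) (Fin 𝔊.N) ℂ} (hX : X ∈ 𝔊.lie) (hX0 : X ≠ 0)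
    (X₀ : ∀ S : Scales θ.L, ExternalInputs S G) (hstd : ∀ S : Scales θ.L, (X₀ S).av = AveragingRT.stdAvg S.P G) (w : ℝ)
    (Bk : ∀ (S : Scales θ.L) (k : ℕ), Hist S.P k → Set (PBond S.P k))
    (𝔖 : ∀ (S : Scales θ.L) (k : ℕ), StepSeries S G ↥(lieC 𝔊) (nblkOf S 𝔠.lane.carrier k) k)
    (𝔄 : ∀ S : Scales θ.L, AlphaData 𝔊 𝔠 (XeOf 𝔊 𝔠 X₀ hstd w hX hX0 hC Bk S) (𝔖 S))
    (coef : ∀ (S : Scales θ.L) (k : ℕ), Hist S.P (k + 1) → GaugeField S.P (k + 1) G → (j : ℕ) → TermSizes (oldGeom S.P k j))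
    (hD : ∀ S : Scales θ.L, S.g ^ 2 * S.ε₀ ≤ (min (gammaN08d 𝔠) 1) ^ 2 →
      RunDataRows 𝔊 𝔠 (XeOf 𝔊 𝔠 X₀ hstd w hX hX0 hC Bk S) (𝔖 S) (𝔄 S) (sizesOf 𝔊 𝔠 (XeOf 𝔊 𝔠 X₀ hstd w hX hX0 hC Bk S) (coef S))) :
    ∃ (θ' : Stage13RParams F N) (h' : θ'.Provisos₁₃CoPR F N) (w' : WorldP), (θ'.ZrUnity F N ∧ θ'.SlotsNondegenerate₁₃ F N) ∧ θ'.Admissible F N ∧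
      IsRecordOfRecord₁₃CCoPR F N (datumOfRecord₁₃CoPR F N θ' h') w' ∧ ∀ P : B12.RunParams, Dag.B10_main (leavesP w' P) := by
  obtain ⟨w', hR, -, -, -, hN⟩ := exists_world₁₃CCoPR_laneXeOf_b10_main_of_data 𝔊 θ h hθ 𝔠 hC hX hX0 X₀ hstd w Bk 𝔖 𝔄 coef hD
    ⟨hθ.toStage9.gamma_pos, le_rfl⟩
  exact ⟨θ, h, w', hG, hθ, hR, hN⟩

/-- **★ «A CORE-KEYED INHABITATION ⟹ N08's CONJUNCT OF A CORE-KEYED STAGE-13 NODES-∃» FROM THE DATA SCHEMA AT `XeOf` ALONE, generic `N` and `G`**: from `∃ θ, Provisos₁₃CoPR ∧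
(ZrUnity ∧ SlotsNondegenerate₁₃) ∧ Admissible` at `F` (HYPOTHESIS `hI`) and, AT EVERY ODD BLOCK SIZE `L > 1`, lane letters `(𝔠, hC, X, hX, hX0, X₀, hstd, w, Bk, 𝔖, 𝔄, coef)` with
the DATA SCHEMA at `XeOf` on the window (HYPOTHESIS `hlane` — the (α) programme's displayed inputs, NO in-edge face) ⟹ N08's conjunct.  NOT the stub, NOT a discharge; the
[B10] layer is the lane's, not print's (module docstring). [cite: Balaban1985UV3, Thm 1 p.257 (compact reading) + Thm 2 p.272 + p.256 L15–18; Balaban1989LargeFieldII, Thm 1 + (0.1) pp.355–356 (bookkeeping)] -/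
theorem exists_guarded_record₁₃CCoPR_laneXeOf_b10_main_of_inhabited13CoPR
    (hI : ∃ θ : Stage13RParams F N, θ.Provisos₁₃CoPR F N ∧ (θ.ZrUnity F N ∧ θ.SlotsNondegenerate₁₃ F N) ∧ θ.Admissible F N)
    (hlane : ∀ L : ℕ, Odd L → 1 < L →
      ∃ (𝔠 : AlphaConsts L 𝔊.N) (hC : 4 * Real.pi ≤ (regMin 𝔠).C68) (X : Matrix (Fin 𝔊.N) (Fin 𝔊.N) ℂ) (hX : X ∈ 𝔊.lie) (hX0 : X ≠ 0)
        (X₀ : ∀ S : Scales L, ExternalInputs S G) (hstd : ∀ S : Scales L, (X₀ S).av = AveragingRT.stdAvg S.P G) (w : ℝ)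
        (Bk : ∀ (S : Scales L) (k : ℕ), Hist S.P k → Set (PBond S.P k))
        (𝔖 : ∀ (S : Scales L) (k : ℕ), StepSeries S G ↥(lieC 𝔊) (nblkOf S 𝔠.lane.carrier k) k)
        (𝔄 : ∀ S : Scales L, AlphaData 𝔊 𝔠 (XeOf 𝔊 𝔠 X₀ hstd w hX hX0 hC Bk S) (𝔖 S))
        (coef : ∀ (S : Scales L) (k : ℕ), Hist S.P (k + 1) → GaugeField S.P (k + 1) G → (j : ℕ) → TermSizes (oldGeom S.P k j)),
        ∀ S : Scales L, S.g ^ 2 * S.ε₀ ≤ (min (gammaN08d 𝔠) 1) ^ 2 →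
          RunDataRows 𝔊 𝔠 (XeOf 𝔊 𝔠 X₀ hstd w hX hX0 hC Bk S) (𝔖 S) (𝔄 S) (sizesOf 𝔊 𝔠 (XeOf 𝔊 𝔠 X₀ hstd w hX hX0 hC Bk S) (coef S))) :
    ∃ (θ : Stage13RParams F N) (h : θ.Provisos₁₃CoPR F N) (w' : WorldP), (θ.ZrUnity F N ∧ θ.SlotsNondegenerate₁₃ F N) ∧ θ.Admissible F N ∧
      IsRecordOfRecord₁₃CCoPR F N (datumOfRecord₁₃CoPR F N θ h) w' ∧ ∀ P : B12.RunParams, Dag.B10_main (leavesP w' P) := by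
  obtain ⟨θ, h, hG, hθ⟩ := hI
  obtain ⟨𝔠, hC, X, hX, hX0, X₀, hstd, w, Bk, 𝔖, 𝔄, coef, hD⟩ := hlane θ.L θ.hL.1 θ.hL.2
  exact exists_guarded_record₁₃CCoPR_laneXeOf_b10_main_of_data 𝔊 θ h hθ hG 𝔠 hC hX hX0 X₀ hstd w Bk 𝔖 𝔄 coef hD

end Generic

/-! ## §2 `G = SU(N)`, `N ≥ 2`, AT THE BUMPED CONSTANTS `bump68 𝔠₀` — direction `suDir`, size condition a theorem (`four_pi_le_regMin_bump68`): NO structural hypothesis -/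

section SU
variable {M : ℕ} [NeZero M]

/-- **★★ `SU(M)`, `M ≥ 2`: A ₁₃CCoPR RECORD OF `datumOfRecord₁₃CoPR F N θ h` BOUND OVER THE CoPR VIEW OF THE LANE-RE-BOUND PARAMETERS AT `XeOf` (lane group `SU(M)`, constants `bump68 𝔠₀`,
direction `suDir`), CARRYING N08 AT EVERY RUN — from base inputs `X₀` (standard averaging), `w`, `Bk`, data `𝔖 ∕ 𝔄 ∕ coef` and THE DATA SCHEMA AT `XeOf` ALONE** (any window `γw`,
block size `θ.L`). [cite: Balaban1985UV3, Thm 1 p.257 (compact reading) + Thm 2 p.272 + (41)–(42) p.266 + (67)–(68) p.273; Balaban1985Variational, Thm 1 p.279; Balaban1989LargeFieldII, Thm 1 + (0.1) pp.355–356 (bookkeeping)] -/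
theorem exists_world₁₃CCoPR_laneXeOf_b10_main_of_data_su_bump (hM : 2 ≤ M) (θ : Stage13RParams F N) (h : θ.Provisos₁₃CoPR F N) (hθ : θ.Admissible F N)
    (𝔠₀ : AlphaConsts θ.L (suGroupModel M).N)
    (X₀ : ∀ S : Scales θ.L, ExternalInputs S (Matrix.specialUnitaryGroup (Fin M) ℂ))
    (hstd : ∀ S : Scales θ.L, (X₀ S).av = AveragingRT.stdAvg S.P (Matrix.specialUnitaryGroup (Fin M) ℂ)) (w : ℝ)
    (Bk : ∀ (S : Scales θ.L) (k : ℕ), Hist S.P k → Set (PBond S.P k))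
    (𝔖 : ∀ (S : Scales θ.L) (k : ℕ), StepSeries S (Matrix.specialUnitaryGroup (Fin M) ℂ) ↥(lieC (suGroupModel M)) (nblkOf S (bump68 𝔠₀).lane.carrier k) k)
    (𝔄 : ∀ S : Scales θ.L, AlphaData (suGroupModel M) (bump68 𝔠₀)
      (XeOf (suGroupModel M) (bump68 𝔠₀) X₀ hstd w (suDir_mem_su hM) (suDir_ne_zero hM) (four_pi_le_regMin_bump68 𝔠₀) Bk S) (𝔖 S))
    (coef : ∀ (S : Scales θ.L) (k : ℕ), Hist S.P (k + 1) → GaugeField S.P (k + 1) (Matrix.specialUnitaryGroup (Fin M) ℂ) → (j : ℕ) → TermSizes (oldGeom S.P k j))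
    (hD : ∀ S : Scales θ.L, S.g ^ 2 * S.ε₀ ≤ (min (gammaN08d (bump68 𝔠₀)) 1) ^ 2 →
      RunDataRows (suGroupModel M) (bump68 𝔠₀)
        (XeOf (suGroupModel M) (bump68 𝔠₀) X₀ hstd w (suDir_mem_su hM) (suDir_ne_zero hM) (four_pi_le_regMin_bump68 𝔠₀) Bk S) (𝔖 S) (𝔄 S)
        (sizesOf (suGroupModel M) (bump68 𝔠₀)
          (XeOf (suGroupModel M) (bump68 𝔠₀) X₀ hstd w (suDir_mem_su hM) (suDir_ne_zero hM) (four_pi_le_regMin_bump68 𝔠₀) Bk S) (coef S)))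
    {γw : ℝ} (hγw : 0 < γw ∧ γw ≤ θ.γ) :
    ∃ w' : WorldP, IsRecordOfRecord₁₃CCoPR F N (datumOfRecord₁₃CoPR F N θ h) w' ∧ w'.γ = γw ∧ w'.L = (θ.L : ℝ) ∧
      (∀ P, w'.up P = upOfRecord₅C F N ((θ.rebindX F N fun P => (θ.res.X P).withTowerRuns10
        fun S : ScalesLE θ.L ((min (gammaN08d (bump68 𝔠₀)) 1) ^ 2) => towerOf (bump68 𝔠₀).lane
          (XeOf (suGroupModel M) (bump68 𝔠₀) X₀ hstd w (suDir_mem_su hM) (suDir_ne_zero hM) (four_pi_le_regMin_bump68 𝔠₀) Bk S.1) (𝔖 S.1)).toStage5₁₃CoPR F N) P) ∧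
      ∀ P : B12.RunParams, Dag.B10_main (leavesP w' P) :=
  exists_world₁₃CCoPR_laneXeOf_b10_main_of_data (suGroupModel M) θ h hθ (bump68 𝔠₀) (four_pi_le_regMin_bump68 𝔠₀) (suDir_mem_su hM) (suDir_ne_zero hM)
    X₀ hstd w Bk 𝔖 𝔄 coef hD hγw

/-- **★★ `SU(M)`, `M ≥ 2`: N08's CONJUNCT SHAPE OF A CORE-KEYED `NodesAtSomeRecord13`, WITNESSED AT `θ`, FROM THE DATA SCHEMA AT `XeOf` ALONE** (plus Core provisos, admissibility,
guard; constants `bump68 𝔠₀`, direction `suDir` — no structural hypothesis). [cite: Balaban1985UV3, Thm 1 p.257 (compact reading) + Thm 2 p.272; Balaban1989LargeFieldII, Thm 1 + (0.1) pp.355–356; Balaban1988Convergent, (3.16)–(3.22) pp.268–269 (bookkeeping)] -/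
theorem exists_guarded_record₁₃CCoPR_laneXeOf_b10_main_of_data_su_bump (hM : 2 ≤ M) (θ : Stage13RParams F N) (h : θ.Provisos₁₃CoPR F N) (hθ : θ.Admissible F N)
    (hG : θ.ZrUnity F N ∧ θ.SlotsNondegenerate₁₃ F N) (𝔠₀ : AlphaConsts θ.L (suGroupModel M).N)
    (X₀ : ∀ S : Scales θ.L, ExternalInputs S (Matrix.specialUnitaryGroup (Fin M) ℂ))
    (hstd : ∀ S : Scales θ.L, (X₀ S).av = AveragingRT.stdAvg S.P (Matrix.specialUnitaryGroup (Fin M) ℂ)) (w : ℝ)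
    (Bk : ∀ (S : Scales θ.L) (k : ℕ), Hist S.P k → Set (PBond S.P k))
    (𝔖 : ∀ (S : Scales θ.L) (k : ℕ), StepSeries S (Matrix.specialUnitaryGroup (Fin M) ℂ) ↥(lieC (suGroupModel M)) (nblkOf S (bump68 𝔠₀).lane.carrier k) k)
    (𝔄 : ∀ S : Scales θ.L, AlphaData (suGroupModel M) (bump68 𝔠₀)
      (XeOf (suGroupModel M) (bump68 𝔠₀) X₀ hstd w (suDir_mem_su hM) (suDir_ne_zero hM) (four_pi_le_regMin_bump68 𝔠₀) Bk S) (𝔖 S))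
    (coef : ∀ (S : Scales θ.L) (k : ℕ), Hist S.P (k + 1) → GaugeField S.P (k + 1) (Matrix.specialUnitaryGroup (Fin M) ℂ) → (j : ℕ) → TermSizes (oldGeom S.P k j))
    (hD : ∀ S : Scales θ.L, S.g ^ 2 * S.ε₀ ≤ (min (gammaN08d (bump68 𝔠₀)) 1) ^ 2 →
      RunDataRows (suGroupModel M) (bump68 𝔠₀)
        (XeOf (suGroupModel M) (bump68 𝔠₀) X₀ hstd w (suDir_mem_su hM) (suDir_ne_zero hM) (four_pi_le_regMin_bump68 𝔠₀) Bk S) (𝔖 S) (𝔄 S)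
        (sizesOf (suGroupModel M) (bump68 𝔠₀)
          (XeOf (suGroupModel M) (bump68 𝔠₀) X₀ hstd w (suDir_mem_su hM) (suDir_ne_zero hM) (four_pi_le_regMin_bump68 𝔠₀) Bk S) (coef S))) :
    ∃ (θ' : Stage13RParams F N) (h' : θ'.Provisos₁₃CoPR F N) (w' : WorldP), (θ'.ZrUnity F N ∧ θ'.SlotsNondegenerate₁₃ F N) ∧ θ'.Admissible F N ∧
      IsRecordOfRecord₁₃CCoPR F N (datumOfRecord₁₃CoPR F N θ' h') w' ∧ ∀ P : B12.RunParams, Dag.B10_main (leavesP w' P) :=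
  exists_guarded_record₁₃CCoPR_laneXeOf_b10_main_of_data (suGroupModel M) θ h hθ hG (bump68 𝔠₀) (four_pi_le_regMin_bump68 𝔠₀) (suDir_mem_su hM) (suDir_ne_zero hM)
    X₀ hstd w Bk 𝔖 𝔄 coef hD

/-- **★★ `SU(M)`, `M ≥ 2`: «A CORE-KEYED INHABITATION ⟹ N08's CONJUNCT OF A CORE-KEYED STAGE-13 NODES-∃» FROM THE DATA SCHEMA AT `XeOf` ALONE** — at every odd block size `L > 1`
lane letters `(𝔠₀, X₀ standard, w, Bk, 𝔖, 𝔄, coef)` with the DATA schema at `XeOf` on the window at the bumped constants; NO in-edge face, NO structural hypothesis.  NOT the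
stub, NOT a discharge. [cite: Balaban1985UV3, Thm 1 p.257 (compact reading) + Thm 2 p.272 + p.256 L15–18; Balaban1989LargeFieldII, Thm 1 + (0.1) pp.355–356 (bookkeeping)] -/
theorem exists_guarded_record₁₃CCoPR_laneXeOf_b10_main_of_inhabited13CoPR_su_bump (hM : 2 ≤ M)
    (hI : ∃ θ : Stage13RParams F N, θ.Provisos₁₃CoPR F N ∧ (θ.ZrUnity F N ∧ θ.SlotsNondegenerate₁₃ F N) ∧ θ.Admissible F N)
    (hlane : ∀ L : ℕ, Odd L → 1 < L →
      ∃ (𝔠₀ : AlphaConsts L (suGroupModel M).N) (X₀ : ∀ S : Scales L, ExternalInputs S (Matrix.specialUnitaryGroup (Fin M) ℂ))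
        (hstd : ∀ S : Scales L, (X₀ S).av = AveragingRT.stdAvg S.P (Matrix.specialUnitaryGroup (Fin M) ℂ)) (w : ℝ)
        (Bk : ∀ (S : Scales L) (k : ℕ), Hist S.P k → Set (PBond S.P k))
        (𝔖 : ∀ (S : Scales L) (k : ℕ), StepSeries S (Matrix.specialUnitaryGroup (Fin M) ℂ) ↥(lieC (suGroupModel M)) (nblkOf S (bump68 𝔠₀).lane.carrier k) k)
        (𝔄 : ∀ S : Scales L, AlphaData (suGroupModel M) (bump68 𝔠₀)
          (XeOf (suGroupModel M) (bump68 𝔠₀) X₀ hstd w (suDir_mem_su hM) (suDir_ne_zero hM) (four_pi_le_regMin_bump68 𝔠₀) Bk S) (𝔖 S))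
        (coef : ∀ (S : Scales L) (k : ℕ), Hist S.P (k + 1) → GaugeField S.P (k + 1) (Matrix.specialUnitaryGroup (Fin M) ℂ) → (j : ℕ) → TermSizes (oldGeom S.P k j)),
        ∀ S : Scales L, S.g ^ 2 * S.ε₀ ≤ (min (gammaN08d (bump68 𝔠₀)) 1) ^ 2 →
          RunDataRows (suGroupModel M) (bump68 𝔠₀)
            (XeOf (suGroupModel M) (bump68 𝔠₀) X₀ hstd w (suDir_mem_su hM) (suDir_ne_zero hM) (four_pi_le_regMin_bump68 𝔠₀) Bk S) (𝔖 S) (𝔄 S)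
            (sizesOf (suGroupModel M) (bump68 𝔠₀)
              (XeOf (suGroupModel M) (bump68 𝔠₀) X₀ hstd w (suDir_mem_su hM) (suDir_ne_zero hM) (four_pi_le_regMin_bump68 𝔠₀) Bk S) (coef S))) :
    ∃ (θ : Stage13RParams F N) (h : θ.Provisos₁₃CoPR F N) (w' : WorldP), (θ.ZrUnity F N ∧ θ.SlotsNondegenerate₁₃ F N) ∧ θ.Admissible F N ∧
      IsRecordOfRecord₁₃CCoPR F N (datumOfRecord₁₃CoPR F N θ h) w' ∧ ∀ P : B12.RunParams, Dag.B10_main (leavesP w' P) := by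
  obtain ⟨θ, h, hG, hθ⟩ := hI
  obtain ⟨𝔠₀, X₀, hstd, w, Bk, 𝔖, 𝔄, coef, hD⟩ := hlane θ.L θ.hL.1 θ.hL.2
  exact exists_guarded_record₁₃CCoPR_laneXeOf_b10_main_of_data_su_bump hM θ h hθ hG 𝔠₀ X₀ hstd w Bk 𝔖 𝔄 coef hD

/-- **★★ THE SAME AT THE GROUPS OF RECORD: the T⁴ side at `N = 2`** (hypothesis `hI` = the Core-keyed inhabitation text at `F 2`) **and the lane at `SU(2)`** (`M = 2`).
[cite: Balaban1985UV3, Thm 1 p.257 (compact reading) + Thm 2 p.272; Balaban1989LargeFieldII, Thm 1 + (0.1) pp.355–356 (bookkeeping)] -/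
theorem exists_guarded_record₁₃CCoPR_laneXeOf_b10_main_of_inhabited13CoPR_su_bump_two (F : T4Family)
    (hI : ∃ θ : Stage13RParams F 2, θ.Provisos₁₃CoPR F 2 ∧ (θ.ZrUnity F 2 ∧ θ.SlotsNondegenerate₁₃ F 2) ∧ θ.Admissible F 2)
    (hlane : ∀ L : ℕ, Odd L → 1 < L →
      ∃ (𝔠₀ : AlphaConsts L (suGroupModel 2).N) (X₀ : ∀ S : Scales L, ExternalInputs S (Matrix.specialUnitaryGroup (Fin 2) ℂ))
        (hstd : ∀ S : Scales L, (X₀ S).av = AveragingRT.stdAvg S.P (Matrix.specialUnitaryGroup (Fin 2) ℂ)) (w : ℝ)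
        (Bk : ∀ (S : Scales L) (k : ℕ), Hist S.P k → Set (PBond S.P k))
        (𝔖 : ∀ (S : Scales L) (k : ℕ), StepSeries S (Matrix.specialUnitaryGroup (Fin 2) ℂ) ↥(lieC (suGroupModel 2)) (nblkOf S (bump68 𝔠₀).lane.carrier k) k)
        (𝔄 : ∀ S : Scales L, AlphaData (suGroupModel 2) (bump68 𝔠₀)
          (XeOf (suGroupModel 2) (bump68 𝔠₀) X₀ hstd w (suDir_mem_su le_rfl) (suDir_ne_zero le_rfl) (four_pi_le_regMin_bump68 𝔠₀) Bk S) (𝔖 S))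
        (coef : ∀ (S : Scales L) (k : ℕ), Hist S.P (k + 1) → GaugeField S.P (k + 1) (Matrix.specialUnitaryGroup (Fin 2) ℂ) → (j : ℕ) → TermSizes (oldGeom S.P k j)),
        ∀ S : Scales L, S.g ^ 2 * S.ε₀ ≤ (min (gammaN08d (bump68 𝔠₀)) 1) ^ 2 →
          RunDataRows (suGroupModel 2) (bump68 𝔠₀)
            (XeOf (suGroupModel 2) (bump68 𝔠₀) X₀ hstd w (suDir_mem_su le_rfl) (suDir_ne_zero le_rfl) (four_pi_le_regMin_bump68 𝔠₀) Bk S) (𝔖 S) (𝔄 S)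
            (sizesOf (suGroupModel 2) (bump68 𝔠₀)
              (XeOf (suGroupModel 2) (bump68 𝔠₀) X₀ hstd w (suDir_mem_su le_rfl) (suDir_ne_zero le_rfl) (four_pi_le_regMin_bump68 𝔠₀) Bk S) (coef S))) :
    ∃ (θ : Stage13RParams F 2) (h : θ.Provisos₁₃CoPR F 2) (w' : WorldP), (θ.ZrUnity F 2 ∧ θ.SlotsNondegenerate₁₃ F 2) ∧ θ.Admissible F 2 ∧
      IsRecordOfRecord₁₃CCoPR F 2 (datumOfRecord₁₃CoPR F 2 θ h) w' ∧ ∀ P : B12.RunParams, Dag.B10_main (leavesP w' P) :=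
  exists_guarded_record₁₃CCoPR_laneXeOf_b10_main_of_inhabited13CoPR_su_bump le_rfl hI hlane

end SU

/-! ## §3 ON K0a's ALL-NUMERICS WITNESS FAMILY `θL F n ε₂₉ = theta13LiveOfNumerics F 2 n ε₂₉ …` (block size `F.L` by `rfl`), CORE PROVISOS OPAQUE, lane `SU(2)` at `bump68 𝔠₀` -/

section Numerics

/-- **★★ N08's CONJUNCT OF A CORE-KEYED ₁₃ NODES-∃ AT `N = 2`, WITNESSED AT THE MEMBER `θL F n ε₂₉`, FROM THE DATA SCHEMA AT `XeOf` ALONE** (lane `SU(2)`, constants `bump68 𝔠₀`,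
block size `F.L`): from `n.Pos`, `0 < ε₂₉`, the member's Core provisos `hP` (HYPOTHESIS, opaque), base inputs `X₀` (standard averaging), `w`, `Bk`, data `𝔖 ∕ 𝔄 ∕ coef` and
`RunDataRows` at `XeOf` on the window — guard and admissibility at `θL` are K0a's theorems BY NAME (HYPOTHESIS-FREE row P12). [cite: Balaban1985UV3, Thm 1 p.257 (compact reading) + Thm 2 p.272; Balaban1988Convergent, (3.16)–(3.22) pp.268–269; Balaban1987RG1, Thm 1 p.255 (bookkeeping)] -/
theorem exists_guarded_record₁₃CCoPR_laneXeOf_b10_main_at_theta13LiveOfNumerics_of_data_su_bump (F : T4Family) (Zr : (p : B12.RunParams) → TkResidualW F 2 (FluctV 2) p.K) {n : Stage12Numerics} {ε₂₉ : ℝ} (hn : n.Pos)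
    (hε' : 0 < ε₂₉) (hP : (⟨theta13LiveOfNumerics F 2 n ε₂₉ (zeta316OfRecord F 2 n.ν n.τ9.M n.A₁) (RzOfRecord F 2) (ZtOfRecord F 2), Zr⟩ : Stage13RParams F 2).Provisos₁₃CoPR F 2)
    (hZ : (⟨theta13LiveOfNumerics F 2 n ε₂₉ (zeta316OfRecord F 2 n.ν n.τ9.M n.A₁) (RzOfRecord F 2) (ZtOfRecord F 2), Zr⟩ : Stage13RParams F 2).ZrUnity F 2)
    (𝔠₀ : AlphaConsts F.L (suGroupModel 2).N) (X₀ : ∀ S : Scales F.L, ExternalInputs S (Matrix.specialUnitaryGroup (Fin 2) ℂ))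
    (hstd : ∀ S : Scales F.L, (X₀ S).av = AveragingRT.stdAvg S.P (Matrix.specialUnitaryGroup (Fin 2) ℂ)) (w : ℝ)
    (Bk : ∀ (S : Scales F.L) (k : ℕ), Hist S.P k → Set (PBond S.P k))
    (𝔖 : ∀ (S : Scales F.L) (k : ℕ), StepSeries S (Matrix.specialUnitaryGroup (Fin 2) ℂ) ↥(lieC (suGroupModel 2)) (nblkOf S (bump68 𝔠₀).lane.carrier k) k)
    (𝔄 : ∀ S : Scales F.L, AlphaData (suGroupModel 2) (bump68 𝔠₀)
      (XeOf (suGroupModel 2) (bump68 𝔠₀) X₀ hstd w (suDir_mem_su le_rfl) (suDir_ne_zero le_rfl) (four_pi_le_regMin_bump68 𝔠₀) Bk S) (𝔖 S))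
    (coef : ∀ (S : Scales F.L) (k : ℕ), Hist S.P (k + 1) → GaugeField S.P (k + 1) (Matrix.specialUnitaryGroup (Fin 2) ℂ) → (j : ℕ) → TermSizes (oldGeom S.P k j))
    (hD : ∀ S : Scales F.L, S.g ^ 2 * S.ε₀ ≤ (min (gammaN08d (bump68 𝔠₀)) 1) ^ 2 →
      RunDataRows (suGroupModel 2) (bump68 𝔠₀)
        (XeOf (suGroupModel 2) (bump68 𝔠₀) X₀ hstd w (suDir_mem_su le_rfl) (suDir_ne_zero le_rfl) (four_pi_le_regMin_bump68 𝔠₀) Bk S) (𝔖 S) (𝔄 S)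
        (sizesOf (suGroupModel 2) (bump68 𝔠₀)
          (XeOf (suGroupModel 2) (bump68 𝔠₀) X₀ hstd w (suDir_mem_su le_rfl) (suDir_ne_zero le_rfl) (four_pi_le_regMin_bump68 𝔠₀) Bk S) (coef S))) :
    ∃ (θ : Stage13RParams F 2) (h : θ.Provisos₁₃CoPR F 2) (w' : WorldP), (θ.ZrUnity F 2 ∧ θ.SlotsNondegenerate₁₃ F 2) ∧ θ.Admissible F 2 ∧
      IsRecordOfRecord₁₃CCoPR F 2 (datumOfRecord₁₃CoPR F 2 θ h) w' ∧ ∀ P : B12.RunParams, Dag.B10_main (leavesP w' P) :=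
  exists_guarded_record₁₃CCoPR_laneXeOf_b10_main_of_data_su_bump le_rfl _ hP (admissible_theta13LiveOfNumerics F 2 _ _ _ hn hε')
    ⟨hZ, slotsNondegenerate₁₃_theta13LiveOfNumerics_of_hasResiduals F 2 n ε₂₉⟩ 𝔠₀ X₀ hstd w Bk 𝔖 𝔄 coef hD

end Numerics

end Summit.QuantumFields.YangMills.BalabanUVNodes.N08AtRecord13CoPRLaneXeOf

end
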